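import Literature.MathematicalPhysics.QuantumFieldTheory.Balaban1983to89.B8Eq1117KLevelRec
import Literature.MathematicalPhysics.QuantumFieldTheory.Balaban1983to89.B8Eq1112LocalRec
import Literature.MathematicalPhysics.QuantumFieldTheory.Balaban1983to89.B8Eq1112QuotientRec
import Literature.MathematicalPhysics.QuantumFieldTheory.Balaban1983to89.B8Eq1115ConcreteRec
import Literature.MathematicalPhysics.QuantumFieldTheory.Balaban1983to89.B8Ineq172ConcreteRec
import Literature.MathematicalPhysics.QuantumFieldTheory.Balaban1983to89.B8Ineq125ConcreteRec
import Literature.MathematicalPhysics.QuantumFieldTheory.Balaban1983to89.B8SectEInLambdaWitness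

/-!
# `Balaban1983to89.B8SectEInLambdaWitnessRec` — RECORD TWIN of `B8SectEInLambdaWitness` ([Balaban1985RegularSpaces] Sect. E pp. 95–97 ∕ [Balaban1985Averaging]
# Prop. 10 p. 50: the two tower-local Sect.-E point estimates (1.115)∕(1.121) = (213)∕(214) and (1.122)–(1.125), WITH `u₁` READ THROUGH A `Λ_j(U₀, α₃)`-WITNESS)
# FOR THE SYMMETRISED CENTRED block averaging (0.4) of [Balaban1987RG1]

statement-level skeleton of published theorems with citation tags; proofs where landed; nothing here is a claim about the Yang–Mills mass gap

T. Bałaban, *Spaces of regular gauge field configurations on a lattice and gauge fixing conditions*, Commun. Math. Phys. **99** (1985) 75–102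
`[Balaban1985RegularSpaces]` ("[6]"): pp. 89–90, 95–97 ((1.112), (1.115), (1.119)–(1.125)); T. Bałaban, *Averaging operations for lattice gauge theories*, Commun. Math.
Phys. **98** (1985) 17–51 `[Balaban1985Averaging]` ("[3]"): Prop. 10 (203)–(214) p. 50, (166)–(167) p. 44, (106) p. 33, Prop. 2 p. 26; T. Bałaban, *Renormalization group
approach to lattice gauge field theories. I*, Commun. Math. Phys. **109** (1987) 249–301 `[Balaban1987RG1]` ("[I]"): (0.3)–(0.4) pp. 252–253.  STATUS: published, refereed.

CITATION HEADER (lean-in-tree rule).  Cell `pub-ymgap`, «N05-REC» stage 2 (director-ym №254∕№255∕№288), item R5-γ (Sect. E for the record; dag-n05-c's remainder list, HANDOFF g26)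
— typed by the LEAD PEN dag-n05-e g39 (inventory `N05-REC-INVENTORY.md` §R5 row `B8SectEInLambdaWitness`: A `witness_unitary_of_glev`, `witness_inv_of_unitary`,
`witness_inv_of_axial`, `witness_inv_of_glev`, `lipschitz_Cnl_tower_of_witness`, `lipschitz1122_tower_of_witness`, `norm_Cnl_le_tower_of_witness`, `eq214_tower_of_witness`).
WHAT IS REPRODUCED = ✓ those eight theorems under the token map (engine `B8SectEInLambdaWitness`, seat `pub-ymgap-dag-n04-b` g3), over the record lemmas
`B8Ineq125ConcreteRec.eq214Z_qprimeIter_of207 ∕ lipschitz1122Z`, `B8Eq1115ConcreteRec.utilGZ_congr_tower ∕ lamAvgGZ_congr_tower`, `B8Ineq172ConcreteRec.glevZ_congr_tower`,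
`B8Eq1112LocalRec.glevZ_clamp_unitary_inLambdaZ`, `B8Eq1112QuotientRec.inLambdaZ_inv`, `B7Prop2Rec.prop2Z_unitaryUnits`, `B8Eq1117KLevelRec.glevZ_on_towers_of_axial`.
TOKEN MAP: `Cnl ∕ Qnl ∕ utilG ∕ lamAvgG ∕ glev ∕ avgIter ∕ InLambda ∕ InAx ∕ Restr129 ↦ CnlZ ∕ QnlZ ∕ utilGZ ∕ lamAvgGZ ∕ glevZ ∕ avgIterZ ∕ InLambdaZ ∕ InAxZ ∕ Restr129Z`; tower
`B8Ineq130.tlo ∕ thi ↦ B8Ineq130Rec.tlo ∕ thi` (CENTRED); regime `(hL : 2 ≤ L) ↦ (hLs : L = 2s+1) (hs1 : 1 ≤ s) (hd : 1 ≤ d)`, `C0 ↦ C0Z`, `2α₀ ≤ c₂′ ↦ 4α₀ ≤ c₂′`; the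
gauge-fixing witness constant `40d·c ↦ 20dKZ·c` with the record smallness of `B7Eq167GeneralRec` ∕ `B8Eq1112LocalRec` (`exp(4c_Zα₀)(1 + 2·131072(d+1)²KZ²c) ≤ 2`,
`KZ·c ≤ c₃`, `1024·d·KZ·c ≤ 1`).  The engine's general-`G` witnesses `witness_of_glev ∕ witness_of_axial` are off the crown's cone and not twinned.  Declaration name =
engine name with the object token `Z` (T5).  Kind «kernel-checked proof», theorems only; no `def`, no `instance`, no `notation`, no existing module modified.
`--supports stmt-QuantumFields-20541` (K0⁷-keyed, COUNT-NEUTRAL).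

## WHAT IS CERTIFIED HERE (kernel; axioms `propext` ∕ `Classical.choice` ∕ `Quot.sound`)
Tower `[tlo L y j, thi L y j] = Bʲ(y)` (centred, `B8Ineq130Rec`); `π^*U₀ := clampCfg (tlo L y j) (thi L y j) U₀`.  A `Λ`-WITNESS for `u₁` at `(j, y)` with constant `α₃`
is a global `ũ` with `InLambdaZ L (π^*U₀) ũ j α₃ L^{−j}` and `u₁ = ũ` on the sites of `Bʲ(y)`.
* §1 `eq214Z_tower_of_witness`, `norm_CnlZ_le_tower_of_witness` — (213)∕(214) = (1.115)∕(1.121) on the tower ∕ at the point `(j, y)`, record structure.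
* §2 `lipschitz1122Z_tower_of_witness`, `lipschitz_CnlZ_tower_of_witness` — (1.122)∕(1.125) on the tower ∕ at the point, record structure.
* §3 `witness_inv_of_unitaryZ`, `witness_unitary_of_glevZ`, `witness_inv_of_glevZ`, `witness_inv_of_axialZ` — the witnesses, record structure.

HONEST SCOPE: by-name composition of record lemmas + the engine's clamp device; nothing of Bałaban's analysis re-proved; `HThm4Rec` UNDISCHARGED; caveat (C-S3-1) + addendum
v4 stand; N05 [B8] DISCHARGED OF RECORD untouched; N05 ∕ N07 NOT discharged; COUNT of record unmoved · K numerically unchanged; one finite `𝕋⁴` programme at fixed `ε`,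
Bałaban AS PRINTED; nothing continuum ∕ ℝ⁴ ∕ OS ∕ mass-gap ∕ Clay.  No `sorry`, no `def`.

[cite: Balaban1985RegularSpaces, (1.112) p.95, (1.115) p.96, (1.119)–(1.125) pp.96–97, p.89; Balaban1985Averaging, Proposition 10 (213)–(214) p.50, (166)–(167) p.44, (106) p.33,
Proposition 2 p.26; Balaban1987RG1, (0.3)–(0.4) pp.252–253]
-/

noncomputable section

open NormedSpace Finset

namespace Literature.MathematicalPhysics.QuantumFieldTheory.Balaban1983to89.B8SectEInLambdaWitnessRec

open B7Prop1Explicit B7Prop2Explicit B7Prop3Flat B7Prop1Local MatrixLog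
open B7Eq170Flat (cj cj_apply)
open B7Prop10General (C6 C4G)
open B7Prop10Flat (one_le_C5)
open B7Prop9Flat (C5')
open B7Eq214General (Cgen)
open B7Eq92Concrete (mgauge)
open B7Eq78Linearization (QprimeIter)
open B7Prop2Rec (AvgClosedZ C0Z avgClosedZ_unitaryUnits prop2Z_unitaryUnits)
open B7Prop4GeneralLevelsRec (cZ KZ gZ_nonneg)
open BlockAveragingZd (avgIterZ)
open B7SectCDGaugeAveragesRec (glevZ)
open B7SectEFLinearisationRec (zdBlockingZ bgTZ InLambdaZ utilGZ lamAvgGZ)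
open B8Ineq130 (inBox_of_le)
open B8Ineq130Rec (tlo thi tlo_le_thi tlo_zero thi_zero)
open B8Ineq172ConcreteRec (glevZ_congr_tower)
open B8Eq1115ConcreteRec (utilGZ_congr_tower lamAvgGZ_congr_tower)
open B8Eq119TwistedAxialRec (InAxZ Restr129Z)
open B8Eq178AveragesRec (QnlZ QnlZ_eq_mlog_utilGZ qprimeIter_bgTZ_eq_lamAvgGZ)
open B8Eq1123ConcreteRec (CnlZ CnlZ_apply)
open B8Ineq125Concrete (C2p C2p_nonneg)
open B8Ineq125ConcreteRec (eq214Z_qprimeIter_of207 lipschitz1122Z)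
open B8Eq1112LocalRec (glevZ_clamp_unitary_inLambdaZ)
open B8Eq1112QuotientRec (inLambdaZ_inv)
open B8Eq1117KLevelRec (glevZ_on_towers_of_axial)

-- `Site` alone could resolve to the torus sites of `Setup.lean`; re-export the `ℤ^d` sites of `B7Prop1Explicit`.
export B7Prop1Explicit (Site)

variable {d : ℕ}

/-! ## §0 Device: the clamped site function `μ ∘ π` and its global (207)-type bounds (centred tower) -/

section Clamp

variable {𝔸 : Type*} [NormedRing 𝔸] [NormedAlgebra ℂ 𝔸] [CompleteSpace 𝔸]
variable {L j : ℕ} {y : Site d} {V : Site d → Fin d → 𝔸ˣ} {μ : Site d → 𝔸} {a t : ℝ}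

omit [NormedAlgebra ℂ 𝔸] [CompleteSpace 𝔸] in
/-- The pair of STRICT (207)-type bounds for `μ ∘ π` on all of `ℤᵈ` (w.r.t. the clamped background `π^*V`) from the same on the centred tower `Bʲ(y)`
(device: on a degenerate bond the transport is `1` and the two values coincide). [folklore] -/
private theorem clampZ_bounds_lt (hlohi : ∀ i, tlo L y j i ≤ thi L y j i) (ht : 0 < t)
    (hb : ∀ x : Site d, InBox (tlo L y j) (thi L y j) x → ‖μ x‖ < a)
    (ha : ∀ (x : Site d) (κ : Fin d), InBox (tlo L y j) (thi L y j) x → InBox (tlo L y j) (thi L y j) (x + e κ) →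
      ‖cj (V x κ) (μ (x + e κ)) - μ x‖ < t) :
    (∀ x : Site d, ‖μ (clamp (tlo L y j) (thi L y j) x)‖ < a) ∧
      ∀ (x : Site d) (κ : Fin d), ‖cj (clampCfg (tlo L y j) (thi L y j) V x κ) (μ (clamp (tlo L y j) (thi L y j) (x + e κ))) -
        μ (clamp (tlo L y j) (thi L y j) x)‖ < t := by
  refine ⟨fun x => hb _ (clamp_inBox hlohi x), fun x κ => ?_⟩
  by_cases hP : tlo L y j κ ≤ x κ ∧ x κ < thi L y j κ
  · have hx := clamp_inBox hlohi x
    have hxe : InBox (tlo L y j) (thi L y j) (clamp (tlo L y j) (thi L y j) x + e κ) := by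
      rw [← clamp_add_e_of hP]; exact clamp_inBox hlohi _
    simp only [clampCfg, hP, and_self, if_true, clamp_add_e_of hP]
    exact ha _ κ hx hxe
  · simp only [clampCfg, hP, if_false, clamp_add_e_of_not (hlohi κ) hP, cj_apply, Units.val_one, inv_one, one_mul, mul_one,
      sub_self, norm_zero]
    exact ht

omit [NormedAlgebra ℂ 𝔸] [CompleteSpace 𝔸] in
/-- The pair of NON-STRICT (207)-type bounds for `μ ∘ π` (the modulus `m ≥ 0` of a difference), centred tower. [folklore] -/
private theorem clampZ_bounds_le (hlohi : ∀ i, tlo L y j i ≤ thi L y j i) (ht : 0 ≤ t)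
    (hb : ∀ x : Site d, InBox (tlo L y j) (thi L y j) x → ‖μ x‖ ≤ a)
    (ha : ∀ (x : Site d) (κ : Fin d), InBox (tlo L y j) (thi L y j) x → InBox (tlo L y j) (thi L y j) (x + e κ) →
      ‖cj (V x κ) (μ (x + e κ)) - μ x‖ ≤ t) :
    (∀ x : Site d, ‖μ (clamp (tlo L y j) (thi L y j) x)‖ ≤ a) ∧
      ∀ (x : Site d) (κ : Fin d), ‖cj (clampCfg (tlo L y j) (thi L y j) V x κ) (μ (clamp (tlo L y j) (thi L y j) (x + e κ))) -
        μ (clamp (tlo L y j) (thi L y j) x)‖ ≤ t := by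
  refine ⟨fun x => hb _ (clamp_inBox hlohi x), fun x κ => ?_⟩
  by_cases hP : tlo L y j κ ≤ x κ ∧ x κ < thi L y j κ
  · have hx := clamp_inBox hlohi x
    have hxe : InBox (tlo L y j) (thi L y j) (clamp (tlo L y j) (thi L y j) x + e κ) := by
      rw [← clamp_add_e_of hP]; exact clamp_inBox hlohi _
    simp only [clampCfg, hP, and_self, if_true, clamp_add_e_of hP]
    exact ha _ κ hx hxe
  · simp only [clampCfg, hP, if_false, clamp_add_e_of_not (hlohi κ) hP, cj_apply, Units.val_one, inv_one, one_mul, mul_one,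
      sub_self, norm_zero]
    exact ht

end Clamp

/-! ## §1 (213)∕(214) = (1.115)∕(1.121) on the centred tower for any `u₁` with a `Λ`-witness -/

section Eq214

variable {𝔸 : Type*} [NormedRing 𝔸] [NormOneClass 𝔸] [NormedAlgebra ℂ 𝔸] [CompleteSpace 𝔸]
variable {L s : ℕ} {G : Subgroup 𝔸ˣ} {j : ℕ} {y : Site d} {U₀ : Site d → Fin d → 𝔸ˣ} {α₀ α₃ α₄ : ℝ} {lam : Site d → 𝔸}
  {u₁ ut : Site d → 𝔸ˣ}

/-- **(213)–(214) OF [3] ON THE CENTRED BLOCK TOWER FOR ANY `u₁` WITH A `Λ_j`-WITNESS, record structure** (twin of `eq214_tower_of_witness`; [6] pp. 89–90 «the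
assumptions of Proposition 10 are satisfied and we have the representation (213) and the bounds (214) [3]»; used at (1.115)∕(1.121) p. 96).  Setting: `L = 2s+1 ≥ 3`, `G ⊂ U1`
averaging-closed for the (0.4) structure, `U₀` `G`-valued and regular ON THE FINE BLOCK `Bʲ(y)` ONLY; `u₁` EQUAL ON THE SITES OF `Bʲ(y)` TO A GLOBAL `ũ ∈ Λ_j(π^*U₀, α₃)`;
`u′ = e^{λ}` with (1.77)∕(207) on `Bʲ(y)` only; the windows of `eq214Z_qprimeIter_of207` in `α₃`.  THEN at every level-`m` site `z` of `Bⁿ(y)` (`n + m = j`):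
`‖Q′_m(u₁, λ)(z) − (Q′_mλ)(z)‖ ≤ 16C′_gen(α₃α₄ + α₄²)·Lᵐ·L^{−j}`.  Proof: the global theorem for `(π^*U₀, λ∘π, ũ)`, transferred by the locality of `ũ′ᵐ` and `Q′_m` on the
centred tower. [cite: Balaban1985RegularSpaces, (1.115) p.96, (1.121) p.96, p.89; Balaban1985Averaging, Proposition 10 (213)–(214) p.50, (166)–(167) p.44; Balaban1987RG1, (0.4) p.253] -/
theorem eq214Z_tower_of_witness (hLs : L = 2 * s + 1) (hs1 : 1 ≤ s) (hd : 1 ≤ d) (hG : AvgClosedZ d L G) (hU₀ : ∀ x κ, U₀ x κ ∈ G)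
    (hα : 0 < α₀) (hα3 : C0Z d * α₀ ≤ 1 / 3) (hα4 : 4 * α₀ ≤ c2' d L)
    (h33 : pdevOn (tlo L y j) (thi L y j) U₀ < α₀ * (((L : ℝ) ^ j)⁻¹) ^ 2) (hL1 : 1 ≤ L)
    (hW : InLambdaZ L (clampCfg (tlo L y j) (thi L y j) U₀) ut j α₃ (((L : ℝ) ^ j)⁻¹))
    (hu₁ : ∀ x : Site d, tlo L y j ≤ x → x ≤ thi L y j → u₁ x = ut x)
    (hα₄ : 0 < α₄) (h177b : ∀ x : Site d, InBox (tlo L y j) (thi L y j) x → ‖lam x‖ < α₄)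
    (h177a : ∀ (x : Site d) (κ : Fin d), InBox (tlo L y j) (thi L y j) x → InBox (tlo L y j) (thi L y j) (x + e κ) →
      ‖cj (U₀ x κ) (lam (x + e κ)) - lam x‖ < α₄ * ((L : ℝ) ^ j)⁻¹)
    (hα₃ : 0 ≤ α₃) (hα₃' : α₃ ≤ 1 / 200) (hs₁ : 200 * C6 d * α₄ ≤ 1) (hs₂ : 12000 * ((d : ℝ) + 1) * L * α₄ ≤ 1)
    (hs₃ : C4G d L * (α₀ + α₃ + 4 * α₄) ≤ 1)
    (hs₄ : 1024 * ((d : ℝ) + 1) * ((d : ℝ) + 4) * L ^ 2 * α₀ ≤ 1) (hs₅ : 32 * ((d : ℝ) + 1) ^ 2 * C6 d * L ^ 2 * α₀ ≤ 1)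
    (hs₆ : 16 * d * C5' d * C6 d * (L : ℝ) ^ 2 * α₀ ≤ 1) (hs₇ : 8 * d * C6 d * L * α₀ ≤ 1)
    {m n : ℕ} (hmn : n + m = j) (z : Site d) (hz : tlo L y n ≤ z) (hz' : z ≤ thi L y n) :
    ‖QnlZ L U₀ (fun x => expUnit (lam x)) u₁ m z - QprimeIter (zdBlockingZ d L) (bgTZ L U₀) m lam z‖
      ≤ 16 * Cgen d * (α₃ * α₄ + α₄ ^ 2) * ((L : ℝ) ^ m * ((L : ℝ) ^ j)⁻¹) := by
  have hlohi : ∀ i, tlo L y j i ≤ thi L y j i := tlo_le_thi L le_rfl j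
  have hUU : ∀ x κ, U₀ x κ ∈ U1 𝔸 := fun x κ => hG.le_U1 (hU₀ x κ)
  have hLj : (0 : ℝ) < (L : ℝ) ^ j := by positivity
  -- the extended data
  set U₀c := clampCfg (tlo L y j) (thi L y j) U₀ with hU₀c_def
  set lamc : Site d → 𝔸 := fun x => lam (clamp (tlo L y j) (thi L y j) x) with hlamc_def
  have hU₀c : ∀ x κ, U₀c x κ ∈ G := clampCfg_mem hU₀
  have h52c : pdev U₀c < α₀ * (((L : ℝ) ^ j)⁻¹) ^ 2 := (pdev_clampCfg_le hlohi hUU).trans_lt h33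
  have h₀ : AgreeOn (tlo L y j) (thi L y j) U₀ U₀c := (clampCfg_agree U₀).symm
  obtain ⟨h207b, h207a⟩ := clampZ_bounds_lt (V := U₀) (μ := lam) hlohi (by positivity : 0 < α₄ * ((L : ℝ) ^ j)⁻¹) h177b h177a
  -- the GLOBAL (213)/(214) for the clamped data and the witness, `k ↦ j`
  have hglob := eq214Z_qprimeIter_of207 hLs hs1 hd hG hU₀c hα hα3 hα4 h52c h207a h207b hW hα₃ hα₃' hs₁ hs₂ hs₃ hs₄ hs₅ hs₆
    hs₇ m (by omega) z
  -- transfer to the original data on the tower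
  have hu' : ∀ x : Site d, tlo L y j ≤ x → x ≤ thi L y j → (fun x => expUnit (lam x)) x = (fun x => expUnit (lamc x)) x :=
    fun x hx hx' => by simp only [hlamc_def, clamp_of_inBox (inBox_of_le hx hx')]
  have hlam : ∀ x : Site d, tlo L y j ≤ x → x ≤ thi L y j → lam x = lamc x :=
    fun x hx hx' => by simp only [hlamc_def, clamp_of_inBox (inBox_of_le hx hx')]
  rw [QnlZ_eq_mlog_utilGZ, qprimeIter_bgTZ_eq_lamAvgGZ, utilGZ_congr_tower hLs h₀ hu' hu₁ m n hmn z hz hz',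
    lamAvgGZ_congr_tower hLs h₀ hlam m n hmn z hz hz']
  rw [QnlZ_eq_mlog_utilGZ, qprimeIter_bgTZ_eq_lamAvgGZ] at hglob
  exact hglob

/-- **(1.121) AT THE POINT `(j, y)` OF `𝔅_k` FOR ANY `u₁` WITH A `Λ_j`-WITNESS, record structure** (twin of `norm_Cnl_le_tower_of_witness`): under the
tower-local (1.33) on `Bʲ(y)`, (1.120) for `μ` at scale `L^{−j}`, and the `α₃`-windows, `‖C′_j(u₁, μ)(y)‖ ≤ C2p·(α₃ + α₄)·α₄`.
[cite: Balaban1985RegularSpaces, (1.121) p.96; Balaban1985Averaging, (214) p.50; Balaban1987RG1, (0.4) p.253] -/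
theorem norm_CnlZ_le_tower_of_witness (hLs : L = 2 * s + 1) (hs1 : 1 ≤ s) (hd : 1 ≤ d) (hG : AvgClosedZ d L G)
    (hU₀ : ∀ x κ, U₀ x κ ∈ G)
    (hα : 0 < α₀) (hα3 : C0Z d * α₀ ≤ 1 / 3) (hα4 : 4 * α₀ ≤ c2' d L)
    (h33 : pdevOn (tlo L y j) (thi L y j) U₀ < α₀ * (((L : ℝ) ^ j)⁻¹) ^ 2) (hL1 : 1 ≤ L)
    (hW : InLambdaZ L (clampCfg (tlo L y j) (thi L y j) U₀) ut j α₃ (((L : ℝ) ^ j)⁻¹))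
    (hu₁ : ∀ x : Site d, tlo L y j ≤ x → x ≤ thi L y j → u₁ x = ut x)
    (hα₄ : 0 < α₄) {μ : Site d → 𝔸}
    (hμb : ∀ x : Site d, InBox (tlo L y j) (thi L y j) x → ‖μ x‖ < α₄)
    (hμa : ∀ (x : Site d) (κ : Fin d), InBox (tlo L y j) (thi L y j) x → InBox (tlo L y j) (thi L y j) (x + e κ) →
      ‖cj (U₀ x κ) (μ (x + e κ)) - μ x‖ < α₄ * ((L : ℝ) ^ j)⁻¹)
    (hα₃ : 0 ≤ α₃) (hα₃' : α₃ ≤ 1 / 200) (hs₁ : 200 * C6 d * α₄ ≤ 1) (hs₂ : 12000 * ((d : ℝ) + 1) * L * α₄ ≤ 1)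
    (hs₃ : C4G d L * (α₀ + α₃ + 4 * α₄) ≤ 1)
    (hs₄ : 1024 * ((d : ℝ) + 1) * ((d : ℝ) + 4) * L ^ 2 * α₀ ≤ 1) (hs₅ : 32 * ((d : ℝ) + 1) ^ 2 * C6 d * L ^ 2 * α₀ ≤ 1)
    (hs₆ : 16 * d * C5' d * C6 d * (L : ℝ) ^ 2 * α₀ ≤ 1) (hs₇ : 8 * d * C6 d * L * α₀ ≤ 1) :
    ‖CnlZ L U₀ u₁ j μ y‖ ≤ C2p d * (α₃ + α₄) * α₄ := by
  have hy : tlo L y 0 ≤ y := by rw [tlo_zero]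
  have hy' : y ≤ thi L y 0 := by rw [thi_zero]
  have h := eq214Z_tower_of_witness hLs hs1 hd hG hU₀ hα hα3 hα4 h33 hL1 hW hu₁ hα₄ hμb hμa hα₃ hα₃' hs₁ hs₂ hs₃ hs₄ hs₅ hs₆
    hs₇ (m := j) (n := 0) (by omega) y hy hy'
  have hLj : (0 : ℝ) < (L : ℝ) ^ j := by positivity
  have e1 : (L : ℝ) ^ j * ((L : ℝ) ^ j)⁻¹ = 1 := mul_inv_cancel₀ hLj.ne'
  rw [e1, mul_one] at h
  rw [CnlZ_apply]
  refine h.trans_eq ?_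
  simp only [C2p]
  ring

end Eq214

/-! ## §2 The Lipschitz bound (1.122)∕(1.125) on the centred tower for any `u₁` with a `Λ`-witness -/

section Lip

variable {𝔸 : Type*} [NormedRing 𝔸] [NormOneClass 𝔸] [NormedAlgebra ℂ 𝔸] [CompleteSpace 𝔸]
variable {L s : ℕ} {G : Subgroup 𝔸ˣ} {j : ℕ} {y : Site d} {U₀ : Site d → Fin d → 𝔸ˣ} {α₀ α₃ α₄ : ℝ}
  {μ₁ μ₂ : Site d → 𝔸} {m : ℝ} {u₁ ut : Site d → 𝔸ˣ}

/-- **THE LIPSCHITZ BOUND OF (1.122)∕(1.125) ON THE CENTRED BLOCK TOWER FOR ANY `u₁` WITH A `Λ_j`-WITNESS, record structure** (twin of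
`lipschitz1122_tower_of_witness`; [6] p. 97 «|C′(λ − H′X₁) − C′(λ − H′X₂)| ≦ C′₂2B′₀(α₃ + α₄)|X₁ − X₂|», region-dependent form).  Setting as `eq214Z_tower_of_witness`;
`μ₁, μ₂` in the half-size set (1.119) on `Bʲ(y)` with `‖(μ₁ − μ₂)(x)‖ ≤ m`, `‖R(U₀(b))(μ₁ − μ₂)(b₊) − (μ₁ − μ₂)(b₋)‖ ≤ mL^{−j}` there (`m ≥ 0`); the windows of `lipschitz1122Z`.
THEN at every level-`m′` site `z` of `Bⁿ(y)` (`n + m′ = j`): `‖C′_{m′}(u₁, μ₁)(z) − C′_{m′}(u₁, μ₂)(z)‖ ≤ C2p·2m·(α₃ + α₄)·L^{m′}L^{−j}`.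
[cite: Balaban1985RegularSpaces, (1.122)–(1.125) pp.96–97, (1.119) p.96; Balaban1985Averaging, Prop. 10 (213)–(214) p.50; Balaban1987RG1, (0.4) p.253] -/
theorem lipschitz1122Z_tower_of_witness (hLs : L = 2 * s + 1) (hs1 : 1 ≤ s) (hd : 1 ≤ d) (hG : AvgClosedZ d L G)
    (hU₀ : ∀ x κ, U₀ x κ ∈ G)
    (hα : 0 < α₀) (hα3 : C0Z d * α₀ ≤ 1 / 3) (hα4 : 4 * α₀ ≤ c2' d L)
    (h33 : pdevOn (tlo L y j) (thi L y j) U₀ < α₀ * (((L : ℝ) ^ j)⁻¹) ^ 2) (hL1 : 1 ≤ L)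
    (hW : InLambdaZ L (clampCfg (tlo L y j) (thi L y j) U₀) ut j α₃ (((L : ℝ) ^ j)⁻¹))
    (hu₁ : ∀ x : Site d, tlo L y j ≤ x → x ≤ thi L y j → u₁ x = ut x)
    (hα₄ : 0 < α₄) (hm : 0 ≤ m)
    (h₁b : ∀ x : Site d, InBox (tlo L y j) (thi L y j) x → ‖μ₁ x‖ < α₄ / 2)
    (h₁a : ∀ (x : Site d) (κ : Fin d), InBox (tlo L y j) (thi L y j) x → InBox (tlo L y j) (thi L y j) (x + e κ) →
      ‖cj (U₀ x κ) (μ₁ (x + e κ)) - μ₁ x‖ < α₄ / 2 * ((L : ℝ) ^ j)⁻¹)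
    (h₂b : ∀ x : Site d, InBox (tlo L y j) (thi L y j) x → ‖μ₂ x‖ < α₄ / 2)
    (h₂a : ∀ (x : Site d) (κ : Fin d), InBox (tlo L y j) (thi L y j) x → InBox (tlo L y j) (thi L y j) (x + e κ) →
      ‖cj (U₀ x κ) (μ₂ (x + e κ)) - μ₂ x‖ < α₄ / 2 * ((L : ℝ) ^ j)⁻¹)
    (hmb : ∀ x : Site d, InBox (tlo L y j) (thi L y j) x → ‖(μ₁ - μ₂) x‖ ≤ m)
    (hma : ∀ (x : Site d) (κ : Fin d), InBox (tlo L y j) (thi L y j) x → InBox (tlo L y j) (thi L y j) (x + e κ) →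
      ‖cj (U₀ x κ) ((μ₁ - μ₂) (x + e κ)) - (μ₁ - μ₂) x‖ ≤ m * ((L : ℝ) ^ j)⁻¹)
    (hα₃ : 0 ≤ α₃) (hα₃' : α₃ ≤ 1 / 200) (hs₁ : 200 * C6 d * α₄ ≤ 1) (hs₂ : 12000 * ((d : ℝ) + 1) * L * α₄ ≤ 1)
    (hs₃ : C4G d L * (α₀ + α₃ + 4 * α₄) ≤ 1)
    (hs₄ : 1024 * ((d : ℝ) + 1) * ((d : ℝ) + 4) * L ^ 2 * α₀ ≤ 1) (hs₅ : 32 * ((d : ℝ) + 1) ^ 2 * C6 d * L ^ 2 * α₀ ≤ 1)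
    (hs₆ : 16 * d * C5' d * C6 d * (L : ℝ) ^ 2 * α₀ ≤ 1) (hs₇ : 8 * d * C6 d * L * α₀ ≤ 1)
    {m' n : ℕ} (hmn : n + m' = j) (z : Site d) (hz : tlo L y n ≤ z) (hz' : z ≤ thi L y n) :
    ‖CnlZ L U₀ u₁ m' μ₁ z - CnlZ L U₀ u₁ m' μ₂ z‖ ≤ C2p d * (2 * m) * (α₃ + α₄) * ((L : ℝ) ^ m' * ((L : ℝ) ^ j)⁻¹) := by
  have hlohi : ∀ i, tlo L y j i ≤ thi L y j i := tlo_le_thi L le_rfl j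
  have hUU : ∀ x κ, U₀ x κ ∈ U1 𝔸 := fun x κ => hG.le_U1 (hU₀ x κ)
  have hLj : (0 : ℝ) < (L : ℝ) ^ j := by positivity
  -- the extended data
  set U₀c := clampCfg (tlo L y j) (thi L y j) U₀ with hU₀c_def
  set μ₁c : Site d → 𝔸 := fun x => μ₁ (clamp (tlo L y j) (thi L y j) x) with hμ₁c_def
  set μ₂c : Site d → 𝔸 := fun x => μ₂ (clamp (tlo L y j) (thi L y j) x) with hμ₂c_def
  have hU₀c : ∀ x κ, U₀c x κ ∈ G := clampCfg_mem hU₀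
  have h52c : pdev U₀c < α₀ * (((L : ℝ) ^ j)⁻¹) ^ 2 := (pdev_clampCfg_le hlohi hUU).trans_lt h33
  have h₀ : AgreeOn (tlo L y j) (thi L y j) U₀ U₀c := (clampCfg_agree U₀).symm
  -- the global (1.119)-type hypotheses for the clamped site functions
  have hβ : 0 < α₄ / 2 * ((L : ℝ) ^ j)⁻¹ := by positivity
  obtain ⟨h₁bc, h₁ac⟩ := clampZ_bounds_lt (V := U₀) (μ := μ₁) hlohi hβ h₁b h₁a
  obtain ⟨h₂bc, h₂ac⟩ := clampZ_bounds_lt (V := U₀) (μ := μ₂) hlohi hβ h₂b h₂a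
  have hdiff : (μ₁c - μ₂c) = fun x => (μ₁ - μ₂) (clamp (tlo L y j) (thi L y j) x) := by
    funext x; simp only [hμ₁c_def, hμ₂c_def, Pi.sub_apply]
  obtain ⟨hmbc', hmac'⟩ := clampZ_bounds_le (V := U₀) (μ := μ₁ - μ₂) hlohi (by positivity : 0 ≤ m * ((L : ℝ) ^ j)⁻¹) hmb hma
  have hmbc : ∀ x : Site d, ‖(μ₁c - μ₂c) x‖ ≤ m := fun x => by rw [hdiff]; exact hmbc' x
  have hmac : ∀ (x : Site d) (κ : Fin d), ‖cj (U₀c x κ) ((μ₁c - μ₂c) (x + e κ)) - (μ₁c - μ₂c) x‖ ≤ m * ((L : ℝ) ^ j)⁻¹ :=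
    fun x κ => by rw [hdiff]; exact hmac' x κ
  -- the GLOBAL Lipschitz bound for the clamped data and the witness, `k ↦ j`
  have hglob := lipschitz1122Z hLs hs1 hd hG hU₀c μ₁c μ₂c hα hα3 hα4 h52c h₁ac h₁bc h₂ac h₂bc hmac hmbc hW hα₃ hα₃' hs₁ hs₂
    hs₃ hs₄ hs₅ hs₆ hs₇ m' (by omega) z
  -- transfer to the original data on the tower
  have hC : ∀ {μ μc : Site d → 𝔸}, (∀ x : Site d, tlo L y j ≤ x → x ≤ thi L y j → μ x = μc x) →
      CnlZ L U₀ u₁ m' μ z = CnlZ L U₀c ut m' μc z := by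
    intro μ μc hμ
    have hu' : ∀ x : Site d, tlo L y j ≤ x → x ≤ thi L y j → (fun x => expUnit (μ x)) x = (fun x => expUnit (μc x)) x :=
      fun x hx hx' => by simp only [hμ x hx hx']
    simp only [CnlZ_apply, QnlZ_eq_mlog_utilGZ]
    rw [qprimeIter_bgTZ_eq_lamAvgGZ L U₀ μ m', qprimeIter_bgTZ_eq_lamAvgGZ L U₀c μc m',
      utilGZ_congr_tower hLs h₀ hu' hu₁ m' n hmn z hz hz', lamAvgGZ_congr_tower hLs h₀ hμ m' n hmn z hz hz']
  have hμ₁ : ∀ x : Site d, tlo L y j ≤ x → x ≤ thi L y j → μ₁ x = μ₁c x :=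
    fun x hx hx' => by simp only [hμ₁c_def, clamp_of_inBox (inBox_of_le hx hx')]
  have hμ₂ : ∀ x : Site d, tlo L y j ≤ x → x ≤ thi L y j → μ₂ x = μ₂c x :=
    fun x hx hx' => by simp only [hμ₂c_def, clamp_of_inBox (inBox_of_le hx hx')]
  rw [hC hμ₁, hC hμ₂]
  exact hglob

/-- **THE LIPSCHITZ SENTENCE AT THE POINT `(j, y)` OF `𝔅_k` FOR ANY `u₁` WITH A `Λ_j`-WITNESS, record structure** (twin of `lipschitz_Cnl_tower_of_witness`):
`‖C′_j(u₁, μ₁)(y) − C′_j(u₁, μ₂)(y)‖ ≤ C2p·2m·(α₃ + α₄)` — the contraction input of (1.117). [cite: Balaban1985RegularSpaces, (1.122)–(1.125) pp.96–97; Balaban1987RG1, (0.4) p.253] -/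
theorem lipschitz_CnlZ_tower_of_witness (hLs : L = 2 * s + 1) (hs1 : 1 ≤ s) (hd : 1 ≤ d) (hG : AvgClosedZ d L G)
    (hU₀ : ∀ x κ, U₀ x κ ∈ G)
    (hα : 0 < α₀) (hα3 : C0Z d * α₀ ≤ 1 / 3) (hα4 : 4 * α₀ ≤ c2' d L)
    (h33 : pdevOn (tlo L y j) (thi L y j) U₀ < α₀ * (((L : ℝ) ^ j)⁻¹) ^ 2) (hL1 : 1 ≤ L)
    (hW : InLambdaZ L (clampCfg (tlo L y j) (thi L y j) U₀) ut j α₃ (((L : ℝ) ^ j)⁻¹))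
    (hu₁ : ∀ x : Site d, tlo L y j ≤ x → x ≤ thi L y j → u₁ x = ut x)
    (hα₄ : 0 < α₄) (hm : 0 ≤ m)
    (h₁b : ∀ x : Site d, InBox (tlo L y j) (thi L y j) x → ‖μ₁ x‖ < α₄ / 2)
    (h₁a : ∀ (x : Site d) (κ : Fin d), InBox (tlo L y j) (thi L y j) x → InBox (tlo L y j) (thi L y j) (x + e κ) →
      ‖cj (U₀ x κ) (μ₁ (x + e κ)) - μ₁ x‖ < α₄ / 2 * ((L : ℝ) ^ j)⁻¹)
    (h₂b : ∀ x : Site d, InBox (tlo L y j) (thi L y j) x → ‖μ₂ x‖ < α₄ / 2)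
    (h₂a : ∀ (x : Site d) (κ : Fin d), InBox (tlo L y j) (thi L y j) x → InBox (tlo L y j) (thi L y j) (x + e κ) →
      ‖cj (U₀ x κ) (μ₂ (x + e κ)) - μ₂ x‖ < α₄ / 2 * ((L : ℝ) ^ j)⁻¹)
    (hmb : ∀ x : Site d, InBox (tlo L y j) (thi L y j) x → ‖(μ₁ - μ₂) x‖ ≤ m)
    (hma : ∀ (x : Site d) (κ : Fin d), InBox (tlo L y j) (thi L y j) x → InBox (tlo L y j) (thi L y j) (x + e κ) →
      ‖cj (U₀ x κ) ((μ₁ - μ₂) (x + e κ)) - (μ₁ - μ₂) x‖ ≤ m * ((L : ℝ) ^ j)⁻¹)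
    (hα₃ : 0 ≤ α₃) (hα₃' : α₃ ≤ 1 / 200) (hs₁ : 200 * C6 d * α₄ ≤ 1) (hs₂ : 12000 * ((d : ℝ) + 1) * L * α₄ ≤ 1)
    (hs₃ : C4G d L * (α₀ + α₃ + 4 * α₄) ≤ 1)
    (hs₄ : 1024 * ((d : ℝ) + 1) * ((d : ℝ) + 4) * L ^ 2 * α₀ ≤ 1) (hs₅ : 32 * ((d : ℝ) + 1) ^ 2 * C6 d * L ^ 2 * α₀ ≤ 1)
    (hs₆ : 16 * d * C5' d * C6 d * (L : ℝ) ^ 2 * α₀ ≤ 1) (hs₇ : 8 * d * C6 d * L * α₀ ≤ 1) :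
    ‖CnlZ L U₀ u₁ j μ₁ y - CnlZ L U₀ u₁ j μ₂ y‖ ≤ C2p d * (2 * m) * (α₃ + α₄) := by
  have hy : tlo L y 0 ≤ y := by rw [tlo_zero]
  have hy' : y ≤ thi L y 0 := by rw [thi_zero]
  have h := lipschitz1122Z_tower_of_witness hLs hs1 hd hG hU₀ hα hα3 hα4 h33 hL1 hW hu₁ hα₄ hm h₁b h₁a h₂b h₂a hmb hma hα₃
    hα₃' hs₁ hs₂ hs₃ hs₄ hs₅ hs₆ hs₇ (m' := j) (n := 0) (by omega) y hy hy'
  have hLj : (0 : ℝ) < (L : ℝ) ^ j := by positivity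
  have e1 : (L : ℝ) ^ j * ((L : ℝ) ^ j)⁻¹ = 1 := mul_inv_cancel₀ hLj.ne'
  rw [e1, mul_one] at h
  exact h

end Lip

/-! ## §3 Witnesses, record structure: the gauge fixing `glevZ_j` (unitary), its inverse, and Theorem 4's inductive `u₁` inverted -/

section WitnessInv

variable {𝔸 : Type*} [CStarAlgebra 𝔸] [Nontrivial 𝔸]
variable {L s : ℕ} {j : ℕ} {y : Site d} {U₀ : Site d → Fin d → 𝔸ˣ} {α₀ α₃ αP c : ℝ} {B : Site d → Fin d → 𝔸}

/-- **A UNITARY `Λ_j`-WITNESS FOR `u₁` GIVES A `Λ_j`-WITNESS FOR `u₁⁻¹` WITH THE SAME `α₃`, record structure** (twin of `witness_inv_of_unitary`; the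
inverse-closure of `Λ_k(U₀, α₃)` for unitary data, [6] (1.112) p. 95 tacit step, `B8Eq1112QuotientRec.inLambdaZ_inv`), at the clamped background `π^*U₀` (unitary-valued, with
unitary (0.4)-averaged levels by Prop. 2 of [3] for the record, `prop2Z_unitaryUnits`, under the tower-local (1.33)): the witness `ũ⁻¹`.  Windows: Prop. 2's and `α₃ ≤ ¼`.
[cite: Balaban1985RegularSpaces, (1.112) p.95; Balaban1985Averaging, (166)–(167) p.44, Prop. 2 p.26; Balaban1987RG1, (0.4) p.253] -/
theorem witness_inv_of_unitaryZ (hLs : L = 2 * s + 1) (hs1 : 1 ≤ s) (hU₀ : ∀ x κ, U₀ x κ ∈ unitaryUnits 𝔸)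
    (hα : 0 < α₀) (hα3 : C0Z d * α₀ ≤ 1 / 3) (hα2 : 2 * α₀ ≤ c2' d L)
    (h33 : pdevOn (tlo L y j) (thi L y j) U₀ < α₀ * (((L : ℝ) ^ j)⁻¹) ^ 2) (hL1 : 1 ≤ L)
    (hα₃ : 0 ≤ α₃) (hα₃' : α₃ ≤ 1 / 4) {u₁ ut : Site d → 𝔸ˣ}
    (hut : ∀ x, ut x ∈ unitaryUnits 𝔸)
    (hW : InLambdaZ L (clampCfg (tlo L y j) (thi L y j) U₀) ut j α₃ (((L : ℝ) ^ j)⁻¹))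
    (hu₁ : ∀ x : Site d, tlo L y j ≤ x → x ≤ thi L y j → u₁ x = ut x) :
    ∃ ut' : Site d → 𝔸ˣ, InLambdaZ L (clampCfg (tlo L y j) (thi L y j) U₀) ut' j α₃ (((L : ℝ) ^ j)⁻¹) ∧
      ∀ x : Site d, tlo L y j ≤ x → x ≤ thi L y j → u₁⁻¹ x = ut' x := by
  have hL : 2 ≤ L := by omega
  have hlohi : ∀ i, tlo L y j i ≤ thi L y j i := tlo_le_thi L le_rfl j
  have hUU : ∀ x κ, U₀ x κ ∈ U1 𝔸 := fun x κ => unitaryUnits_le_U1 (hU₀ x κ)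
  have hLj : (0 : ℝ) < (L : ℝ) ^ j := by positivity
  set U₀c := clampCfg (tlo L y j) (thi L y j) U₀ with hU₀c_def
  have hU₀c : ∀ x κ, U₀c x κ ∈ unitaryUnits 𝔸 := clampCfg_mem hU₀
  have h52c : pdev U₀c < α₀ * (((L : ℝ) ^ j)⁻¹) ^ 2 := (pdev_clampCfg_le hlohi hUU).trans_lt h33
  -- the (0.4)-averaged levels of the clamped background are unitary (Prop. 2 of [3], record)
  have hV : ∀ i < j, ∀ (x : Site d) (κ : Fin d), avgIterZ L U₀c i x κ ∈ unitaryUnits 𝔸 := fun i hi x κ =>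
    (prop2Z_unitaryUnits L hL j U₀c hU₀c hα hα3 hα2 h52c).2 i hi.le x κ
  have hsm : α₃ * (L : ℝ) ^ j * ((L : ℝ) ^ j)⁻¹ ≤ 1 / 4 := by
    rw [mul_assoc, mul_inv_cancel₀ hLj.ne', mul_one]; exact hα₃'
  refine ⟨ut⁻¹, inLambdaZ_inv hV hut hW hL1 (by positivity) hα₃ hsm, fun x hx hx' => ?_⟩
  rw [Pi.inv_apply, Pi.inv_apply, hu₁ x hx hx']

/-- **THE RECORD GAUGE FIXING `glevZ_j` HAS A UNITARY `Λ_j`-WITNESS** (twin of `witness_unitary_of_glev`; unitary data): under the tower-local (1.33) on `Bʲ(y)`, (1.69)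
on the bonds of `Bʲ(y)` with `e^{B}` unitary-valued, the plaquette regularity of the full small field `e^{B}U₀` on `Bʲ(y)` (`αP`) and the windows of
`B8Eq1112LocalRec.glevZ_clamp_unitary_inLambdaZ`, any `u₁` with `u₁ = glevZ L _ U₀ e^{B} j 0` on `Bʲ(y)` agrees there with the global (0.4) gauge fixing of the CLAMPED data
`(π^*U₀, π^*e^{B})`, unitary-valued and in `Λ_j(π^*U₀, 20dKZ·c)`. [cite: Balaban1985RegularSpaces, p.89, (1.69) p.88, (1.112) p.95; Balaban1985Averaging, (106) p.33, (166)–(167) p.44; Balaban1987RG1, (0.4) p.253] -/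
theorem witness_unitary_of_glevZ (hLs : L = 2 * s + 1) (hs1 : 1 ≤ s) (hd : 1 ≤ d) (hU₀ : ∀ x κ, U₀ x κ ∈ unitaryUnits 𝔸)
    (hα : 0 < α₀) (hα3 : C0Z d * α₀ ≤ 1 / 3) (hα4 : 4 * α₀ ≤ c2' d L)
    (h33 : pdevOn (tlo L y j) (thi L y j) U₀ < α₀ * (((L : ℝ) ^ j)⁻¹) ^ 2) (hc : 0 ≤ c)
    (hsmall : Real.exp (4 * cZ d * α₀) * (1 + 2 * (131072 * ((d : ℝ) + 1) ^ 2) * (KZ d L) ^ 2 * c) ≤ 2)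
    (hc₃ : KZ d L * c ≤ c3 d L) (hsm : 1024 * (d : ℝ) * KZ d L * c ≤ 1)
    (hαP : 0 < αP) (hαP3 : C0Z d * αP ≤ 1 / 3) (hαP2 : 2 * αP ≤ c2' d L) (hL1 : 1 ≤ L)
    (hBu : ∀ (x : Site d) (κ : Fin d), expCfg B x κ ∈ unitaryUnits 𝔸)
    (h69 : ∀ (x : Site d) (κ : Fin d), InBox (tlo L y j) (thi L y j) x → InBox (tlo L y j) (thi L y j) (x + e κ) →
      ‖B x κ‖ ≤ c * ((L : ℝ) ^ j)⁻¹)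
    (hP : pdevOn (tlo L y j) (thi L y j) (expCfg B * U₀) < αP * (((L : ℝ) ^ j)⁻¹) ^ 2) {u₁ : Site d → 𝔸ˣ}
    (hu₁ : ∀ x : Site d, tlo L y j ≤ x → x ≤ thi L y j → u₁ x = glevZ L hL1 U₀ (expCfg B) j 0 x) :
    ∃ ut : Site d → 𝔸ˣ, (∀ x, ut x ∈ unitaryUnits 𝔸) ∧
      InLambdaZ L (clampCfg (tlo L y j) (thi L y j) U₀) ut j (20 * d * KZ d L * c) (((L : ℝ) ^ j)⁻¹) ∧
      ∀ x : Site d, tlo L y j ≤ x → x ≤ thi L y j → u₁ x = ut x := by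
  obtain ⟨hun, hΛ⟩ := glevZ_clamp_unitary_inLambdaZ (y := y) (j := j) (B := B) hLs hs1 hd hU₀ hα hα3 hα4 h33 hc hsmall hc₃ hsm
    hαP hαP3 hαP2 hL1 hBu h69 hP
  have h₀ : AgreeOn (tlo L y j) (thi L y j) U₀ (clampCfg (tlo L y j) (thi L y j) U₀) := (clampCfg_agree U₀).symm
  have h₁ : AgreeOn (tlo L y j) (thi L y j) (expCfg B) (clampCfg (tlo L y j) (thi L y j) (expCfg B)) :=
    (clampCfg_agree (expCfg B)).symm
  refine ⟨_, hun, hΛ, fun x hx hx' => ?_⟩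
  rw [hu₁ x hx hx']
  exact glevZ_congr_tower hLs hL1 h₀ h₁ j 0 (by omega) x hx hx'

/-- **`(glevZ_j)⁻¹` HAS A `Λ_j`-WITNESS WITH THE SAME `α₃ = 20dKZ·c`, record structure** (twin of `witness_inv_of_glev`) — `witness_unitary_of_glevZ` +
`witness_inv_of_unitaryZ`: for `u₁ = glevZ_j` on `Bʲ(y)` (unitary data, windows as there), the INVERSE `u₁⁻¹` agrees on `Bʲ(y)` with a global member of `Λ_j(π^*U₀, 20dKZ·c)`.
[cite: Balaban1985RegularSpaces, (1.112) p.95, p.97; Balaban1985Averaging, Prop. 10 p.50, (166)–(167) p.44; Balaban1987RG1, (0.4) p.253] -/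
theorem witness_inv_of_glevZ (hLs : L = 2 * s + 1) (hs1 : 1 ≤ s) (hd : 1 ≤ d) (hU₀ : ∀ x κ, U₀ x κ ∈ unitaryUnits 𝔸)
    (hα : 0 < α₀) (hα3 : C0Z d * α₀ ≤ 1 / 3) (hα4 : 4 * α₀ ≤ c2' d L)
    (h33 : pdevOn (tlo L y j) (thi L y j) U₀ < α₀ * (((L : ℝ) ^ j)⁻¹) ^ 2) (hc : 0 ≤ c)
    (hsmall : Real.exp (4 * cZ d * α₀) * (1 + 2 * (131072 * ((d : ℝ) + 1) ^ 2) * (KZ d L) ^ 2 * c) ≤ 2)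
    (hc₃ : KZ d L * c ≤ c3 d L) (hsm : 1024 * (d : ℝ) * KZ d L * c ≤ 1)
    (hαP : 0 < αP) (hαP3 : C0Z d * αP ≤ 1 / 3) (hαP2 : 2 * αP ≤ c2' d L) (hL1 : 1 ≤ L)
    (hBu : ∀ (x : Site d) (κ : Fin d), expCfg B x κ ∈ unitaryUnits 𝔸)
    (h69 : ∀ (x : Site d) (κ : Fin d), InBox (tlo L y j) (thi L y j) x → InBox (tlo L y j) (thi L y j) (x + e κ) →
      ‖B x κ‖ ≤ c * ((L : ℝ) ^ j)⁻¹)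
    (hP : pdevOn (tlo L y j) (thi L y j) (expCfg B * U₀) < αP * (((L : ℝ) ^ j)⁻¹) ^ 2) {u₁ : Site d → 𝔸ˣ}
    (hu₁ : ∀ x : Site d, tlo L y j ≤ x → x ≤ thi L y j → u₁ x = glevZ L hL1 U₀ (expCfg B) j 0 x) :
    ∃ ut' : Site d → 𝔸ˣ, InLambdaZ L (clampCfg (tlo L y j) (thi L y j) U₀) ut' j (20 * d * KZ d L * c) (((L : ℝ) ^ j)⁻¹) ∧
      ∀ x : Site d, tlo L y j ≤ x → x ≤ thi L y j → u₁⁻¹ x = ut' x := by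
  obtain ⟨ut, hun, hΛ, hag⟩ := witness_unitary_of_glevZ hLs hs1 hd hU₀ hα hα3 hα4 h33 hc hsmall hc₃ hsm hαP hαP3 hαP2 hL1 hBu
    h69 hP hu₁
  have hK : 0 ≤ KZ d L := by unfold KZ; have := gZ_nonneg d L; positivity
  have h20 : 20 * (d : ℝ) * KZ d L * c ≤ 1 / 4 := by
    have h0 : 0 ≤ (d : ℝ) * KZ d L * c := by positivity
    nlinarith [hsm, h0]
  exact witness_inv_of_unitaryZ hLs hs1 hU₀ hα hα3 (by linarith) h33 hL1 (by positivity) h20 hun hΛ hag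

/-- **THEOREM 4'S INDUCTIVE `u₁`, INVERTED, HAS A `Λ_j`-WITNESS AT EVERY POINT OF `𝔅_k`, record structure** (twin of `witness_inv_of_axial`) — for `u₁` with
`U₁^{u₁}U₀ ∈ Ax_k(𝔅_k, U₀)` (`InAxZ`, `U₁ = e^{B}`) and (1.29) (`Restr129Z`), «`u₁` is given by (106)» on every centred tower (`B8Eq1117KLevelRec.glevZ_on_towers_of_axial`), hence by
`witness_inv_of_glevZ`: for all `j ≤ k`, `y ∈ Λ_j`, the inverse `u₁⁻¹` agrees on `Bʲ(y)` with a global member of `Λ_j(π^*U₀, 20dKZ·c)`.  THE ORIGINAL PAIR'S REGIME ONLY.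
[cite: Balaban1985RegularSpaces, p.88 (after (1.69)), (1.19) p.79, (1.29) p.81, (1.112) p.95, p.97; Balaban1985Averaging, (106) p.33; Balaban1987RG1, (0.4) p.253] -/
theorem witness_inv_of_axialZ (hLs : L = 2 * s + 1) (hs1 : 1 ≤ s) (hd : 1 ≤ d) (hU₀ : ∀ x κ, U₀ x κ ∈ unitaryUnits 𝔸) {k : ℕ}
    (Λ : ℕ → Set (Site d))
    (hα : 0 < α₀) (hα3 : C0Z d * α₀ ≤ 1 / 3) (hα4 : 4 * α₀ ≤ c2' d L) (hc : 0 ≤ c)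
    (hsmall : Real.exp (4 * cZ d * α₀) * (1 + 2 * (131072 * ((d : ℝ) + 1) ^ 2) * (KZ d L) ^ 2 * c) ≤ 2)
    (hc₃ : KZ d L * c ≤ c3 d L) (hsm : 1024 * (d : ℝ) * KZ d L * c ≤ 1)
    (hαP : 0 < αP) (hαP3 : C0Z d * αP ≤ 1 / 3) (hαP2 : 2 * αP ≤ c2' d L) (hL1 : 1 ≤ L)
    (hBu : ∀ (x : Site d) (κ : Fin d), expCfg B x κ ∈ unitaryUnits 𝔸)
    (h33 : ∀ j, j ≤ k → ∀ y ∈ Λ j, pdevOn (tlo L y j) (thi L y j) U₀ < α₀ * (((L : ℝ) ^ j)⁻¹) ^ 2)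
    (h69 : ∀ j, j ≤ k → ∀ y ∈ Λ j, ∀ (x : Site d) (κ : Fin d), InBox (tlo L y j) (thi L y j) x →
      InBox (tlo L y j) (thi L y j) (x + e κ) → ‖B x κ‖ ≤ c * ((L : ℝ) ^ j)⁻¹)
    (hP : ∀ j, j ≤ k → ∀ y ∈ Λ j, pdevOn (tlo L y j) (thi L y j) (expCfg B * U₀) < αP * (((L : ℝ) ^ j)⁻¹) ^ 2)
    {u₁ : Site d → 𝔸ˣ} (hAx : InAxZ L k Λ U₀ (mgauge U₀ u₁ (expCfg B) * U₀)) (h129 : Restr129Z L k Λ U₀ u₁) :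
    ∀ j, j ≤ k → ∀ y ∈ Λ j, ∃ ut' : Site d → 𝔸ˣ,
      InLambdaZ L (clampCfg (tlo L y j) (thi L y j) U₀) ut' j (20 * d * KZ d L * c) (((L : ℝ) ^ j)⁻¹) ∧
      ∀ x : Site d, tlo L y j ≤ x → x ≤ thi L y j → u₁⁻¹ x = ut' x := fun j hj y hy =>
  witness_inv_of_glevZ hLs hs1 hd hU₀ hα hα3 hα4 (h33 j hj y hy) hc hsmall hc₃ hsm hαP hαP3 hαP2 hL1 hBu (h69 j hj y hy)
    (hP j hj y hy) (glevZ_on_towers_of_axial hLs hL1 Λ hAx h129 j hj y hy)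

end WitnessInv

end Literature.MathematicalPhysics.QuantumFieldTheory.Balaban1983to89.B8SectEInLambdaWitnessRec

end
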